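import Mathlib
import Summits.NavierStokesRegularity.FluidComputer.GalerkinFluxCeiling
import HarnessLib

/-!
# The flux ceiling in Bernstein form: what a GAPPED support can carry (the `α ≤ 5/2` intermittency
# ceiling of the exact Galerkin system, kernel form)

HONEST FRAMING (cell `ns-blowup`, seat `ns-blowup-circuit` g5, human ruling D-0035): nothing here is
a claim about Navier–Stokes blow-up. WHAT THIS IS NOT: not NS; a corollary of
`GalerkinFluxCeiling.sqrt_outsideEnergy_le_max` for finite exact-coefficient Galerkin systems, with
the inside coherence `σ_I` replaced by its worst case.

Companion (part 2, split by the 400-line rule) of `GalerkinFluxCeiling.lean` (p437361). The inside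
ℓ¹-strain of ANY field is at most the fully coherent value `σ_I ≤ KI·√(#I)·√(2E_I)`
(`lowStrain_le_sqrt_card`, lattice Bernstein — all phases aligned at one point), so the outside-energy
ceiling holds with `σ := KI·√M·√E₀` and NO coherence hypothesis:

* `sqrt_outsideEnergy_le_max_bernstein` — `√(2E_O(t)) ≤ max(√(2E_O(0)), (KI·√M·E₀ + Φ)/(ν·K_O²))`
  (`#I ≤ M`, inside modes `|p| ≤ KI`, outside modes `|k|² ≥ K_O²`, energy `Σ|û|² ≤ E₀`, outside
  force `≤ Φ`);
* `sqrt_outsideEnergy_le_max_bernstein_unforced` — the unforced form (`E₀ = 2E(0)`, `Φ = 0`).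

READING (memo `CIRCUIT-OBSTRUCTIONS.md` §I, and the cell's rate table): with `M ≲ KI³` (a full ball
of modes below `KI`, ANY thickness) the cap is `≲ KI^{5/2}·E₀/(ν K_O²)`; on a GAPPED support whose
next level starts at `K_O = KI^b` it is `KI^{5/2-2b} E₀/ν → 0` as soon as `b > 5/4`. So a
super-lacunary exact-coefficient tower with gap exponent `b > 5/4` cannot cascade at true viscosity
however thick its levels are, uniformly in the truncation — the Galerkin mirror of S. Palasek's
admissibility `2b < β < α ≤ 5/2` (arXiv:2605.13827 §3 (3.2), Rem. 1.5), which forces `b < 5/4` for his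
model towers: `α = 5/2` IS the Bernstein-saturating (fully coherent) level, and exact coefficients
cannot do better. For `b ≤ 5/4` (in particular λ-adic supports, Tao's `1 + ε₀` spacing, thin octave
shells) nothing here bites. All proved, 0 sorry, no definitions.
-/

noncomputable section

namespace Summit.NavierStokesRegularity.FluidComputer.GalerkinFluxCeiling

open Set Finset Literature.Analysis.FluidPDE.FluidComputer
  Literature.Analysis.FluidPDE.FluidComputer.ShellTransfer
open scoped ComplexConjugate

/-! ## The Bernstein form of the outside-energy ceiling -/

/-- **Outside-energy ceiling in BERNSTEIN form (no coherence hypothesis).** Along a supported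
Galerkin solution on the disjoint split `I ∪ O` (`ν > 0`, outside modes `|k|² ≥ K2 > 0`), if the
inside modes satisfy `|p| ≤ KI` and there are at most `M` of them (`#I ≤ M`), the energy obeys
`Σ|û|² ≤ E₀` and the outside force `≤ Φ` on `[0,T)`, then for all `t ∈ [0,T]`
`√(2E_O(t)) ≤ max( √(2E_O(0)), (KI·√M·√E₀·√E₀ + Φ)/(ν·K2) )`:
the inside ℓ¹-strain never exceeds the fully coherent (all phases aligned) value `KI·√M·√E₀`
(`lowStrain_le_sqrt_card`), so this is `sqrt_outsideEnergy_le_max` with `σ = KI·√M·√E₀`. READING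
(memo §I / Palasek's intermittency ceiling `α ≤ 5/2`): with `M ≲ KI³` the bound is
`≲ KI^{5/2}·E₀/(ν·K2)`; on a GAPPED support whose next level starts at `K_O = KI^b` this is
`KI^{5/2-2b}·E₀/ν → 0` as soon as `b > 5/4` — a super-lacunary exact-coefficient tower with gap
exponent `b > 5/4` cannot cascade at true viscosity HOWEVER THICK its levels are (consistent with
Palasek's admissibility `2b < β < α ≤ 5/2`, which forces `b < 5/4` for his model towers). -/
theorem sqrt_outsideEnergy_le_max_bernstein {U : ℝ → FourierVelocity} {I O : Finset (Fin 3 → ℤ)}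
    (hIO : Disjoint I O) {ν : ℝ} {c : ℝ → (Fin 3 → ℤ) → ℂ} {f : ℝ → (Fin 3 → ℤ) → Fin 3 → ℂ}
    (hU : IsGalerkinSolution U (I ∪ O) ν c f) (hsupp : IsSupportedOn U (I ∪ O)) (hν : 0 < ν)
    {K2 : ℝ} (hK2 : 0 < K2) (hK : ∀ k ∈ O, K2 ≤ knormSq k)
    {KI M : ℝ} (hKI : 0 ≤ KI) (htop : ∀ p ∈ I, Real.sqrt (knormSq p) ≤ KI) (hM : (I.card : ℝ) ≤ M)
    {T E₀ Φ : ℝ}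
    (henergy : ∀ t ∈ Ico 0 T, 2 * truncEnergy (U t) (I ∪ O) ≤ E₀)
    (hforce : ∀ t ∈ Ico 0 T, Real.sqrt (∑ k ∈ O, ∑ j, Complex.normSq (f t k j)) ≤ Φ) :
    ∀ t ∈ Icc 0 T, Real.sqrt (2 * truncEnergy (U t) O) ≤
      max (Real.sqrt (2 * truncEnergy (U 0) O))
        ((KI * Real.sqrt M * Real.sqrt E₀ * Real.sqrt E₀ + Φ) / (ν * K2)) := by
  have hσ0 : 0 ≤ KI * Real.sqrt M * Real.sqrt E₀ := by positivity
  refine sqrt_outsideEnergy_le_max hIO hU hsupp hν hK2 hK hσ0 henergy ?_ hforce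
  intro t ht
  -- σ_I(t) ≤ KI·√(#I)·√(2E_I(t)) ≤ KI·√M·√E₀
  have h1 := lowStrain_le_sqrt_card (U t) I hKI htop
  have hEI : 2 * truncEnergy (U t) I ≤ E₀ := by
    have hsub : truncEnergy (U t) I ≤ truncEnergy (U t) (I ∪ O) := by
      unfold truncEnergy
      exact Finset.sum_le_sum_of_subset_of_nonneg Finset.subset_union_left
        fun k _ _ => modalEnergy_nonneg (U t) k
    linarith [henergy t ht]
  have h2 : Real.sqrt (I.card : ℝ) ≤ Real.sqrt M := Real.sqrt_le_sqrt hM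
  have h3 : Real.sqrt (2 * truncEnergy (U t) I) ≤ Real.sqrt E₀ := Real.sqrt_le_sqrt hEI
  calc ∑ p ∈ I, Real.sqrt (knormSq p) * Real.sqrt (2 * modalEnergy (U t) p)
      ≤ KI * (Real.sqrt I.card * Real.sqrt (2 * truncEnergy (U t) I)) := h1
    _ ≤ KI * (Real.sqrt M * Real.sqrt E₀) := by
        refine mul_le_mul_of_nonneg_left ?_ hKI
        exact mul_le_mul h2 h3 (Real.sqrt_nonneg _) (Real.sqrt_nonneg _)
    _ = KI * Real.sqrt M * Real.sqrt E₀ := by ring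

/-- **Unforced Bernstein form**: `√(2E_O(t)) ≤ max(√(2E_O(0)), KI·√M·2E(0)/(ν·K2))` for all
`t ∈ [0,T]` — energy above a spectral gap is capped by the square of the total energy times
`KI·√(#I)/(ν K_O²)`, uniformly in time, for EVERY exact-coefficient Galerkin system on `I ∪ O`
(no sparseness, no coherence hypothesis). -/
theorem sqrt_outsideEnergy_le_max_bernstein_unforced {U : ℝ → FourierVelocity}
    {I O : Finset (Fin 3 → ℤ)} (hIO : Disjoint I O) {ν : ℝ} {c : ℝ → (Fin 3 → ℤ) → ℂ}
    (hU : IsGalerkinSolution U (I ∪ O) ν c fun _ _ _ => 0) (hsupp : IsSupportedOn U (I ∪ O))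
    (hν : 0 < ν) {K2 : ℝ} (hK2 : 0 < K2) (hK : ∀ k ∈ O, K2 ≤ knormSq k)
    {KI M : ℝ} (hKI : 0 ≤ KI) (htop : ∀ p ∈ I, Real.sqrt (knormSq p) ≤ KI) (hM : (I.card : ℝ) ≤ M)
    {T : ℝ} :
    ∀ t ∈ Icc 0 T, Real.sqrt (2 * truncEnergy (U t) O) ≤
      max (Real.sqrt (2 * truncEnergy (U 0) O))
        (KI * Real.sqrt M * (2 * truncEnergy (U 0) (I ∪ O)) / (ν * K2)) := by
  have hE00 : 0 ≤ 2 * truncEnergy (U 0) (I ∪ O) := by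
    have := Finset.sum_nonneg fun k (_ : k ∈ I ∪ O) => modalEnergy_nonneg (U 0) k
    unfold truncEnergy; positivity
  have h := sqrt_outsideEnergy_le_max_bernstein (T := T) (Φ := 0)
    (E₀ := 2 * truncEnergy (U 0) (I ∪ O)) hIO hU hsupp hν hK2 hK hKI htop hM
    (fun t ht => by
      have h0 := truncEnergy_antitone hν.le hU ht.1
      simp only at h0
      linarith)
    (fun t _ => by simp)
  have hsq : Real.sqrt (2 * truncEnergy (U 0) (I ∪ O)) * Real.sqrt (2 * truncEnergy (U 0) (I ∪ O)) =
      2 * truncEnergy (U 0) (I ∪ O) := Real.mul_self_sqrt hE00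
  intro t ht
  have h' := h t ht
  rw [add_zero, mul_assoc (KI * Real.sqrt M), hsq] at h'
  exact h'


end Summit.NavierStokesRegularity.FluidComputer.GalerkinFluxCeiling
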